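/-
Copyright (c) 2026 the pub-hodgecm-mathlib formalisation cell (harness21).  Prover seat hodgecm-mathlib-F0P3a-p02 (g22): N8 ROAD CENSUS v0 (fd90e2d340c810dd) CUT B —
the `hα`-twins of the letter-L1 frame-form closers, so that the Harish-Chandra family engine of row 3 applies to the QUASI-SPLIT frame of `G_∞ = U(Φ₃)_∞` (isotropic).  THEOREMS ONLY.
-/
import Literature.NumberTheory.Rogawski1990.ArchOrbFamGExtCrossCornerUnfolded   -- ★ p851496 (p02 (g21)): Layer A′ `…_of_unfoldedCornerDescent` (hα-free), `exists_descent_box_orbFamGExt_inRegG_corners_fin (hα)`, the ORIGINALS twinned here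
import HarnessLib

/-!
# (I₁) at the cross-place corners for a NON-DEGENERATE diagonal frame — the `hα`-twins of ★ `ArchOrbFamGExtCrossCornerUnfolded` (N8 census CUT B)

Topic `NumberTheory/Rogawski1990`; namespace `Literature.NumberTheory.Rogawski1990`.  THEOREMS ONLY (no `def`, no instance, no notation, no axiom, no named fact, no `sorry`).
Cell `pub/hodgecm-mathlib`, crux H413 (`stmt-HodgeConjecture-24833`); N8 ROAD CENSUS v0 `F0/P3a/F0P3a-p02/g22/N8-ROAD-CENSUS.v0.F0P3ap02g22.md` §4 CUT B ∕ §5 (1) (LEAD T13-39: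
price tag; LH10-p02 (g8) 14:06Z default + this seat's co-hand split: CROSS + MIXED here, JUMP∕FACES∕CENTRAL∕HEAD by LH10-p02).  Count-neutral.

WHY.  The letter-L1 closers of row 3 (`stub_N9`) are stated in the LEAF'S house frame `(hherm, hanis)` — `hanis` = anisotropy of `diag α`, which the crux's inner form has.  Their
bodies read `hanis` ONLY through ★ `ne_zero_of_diagonal_anisotropic hanis : ∀ i, α i ≠ 0`; every engine underneath takes `(hα : ∀ i, α i ≠ 0) (hreal)`.  The quasi-split group
`G_∞ = U(Φ₃)(L⁺ ⊗ ℝ)` of row 2 (archimedean INNER transfer `stub_N8`) is the diagonal frame `β = (½, 1, −½)` up to ★ `formCongr_quasiSplitFrame_diagonal`, with `hherm` ✓,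
`hα` ✓ and `hanis` ✗ (`β` is isotropic).  These twins swap the binder and NOTHING ELSE (bodies verbatim), so the L1 conclusion (I₁) at the cross-place corners is available on `β`.
* `crossCornerJetBounds_of_unfoldedCornerDescent_of_ne_zero` — Layer B′ with `hα`;
* `crossCornerJetBounds_of_ne_zero` — the organ text of O-L1e (`HcCrossCornerJetBoundsStatement`'s body) under `(hherm) (hα)`.

HONEST LABEL: HC_CM is proved only modulo the 7 printed citations (2 remaining: hLiu418 = `stmt-HodgeConjecture-24832`, h413 = `stmt-HodgeConjecture-24833`) until rung 0 closes; this file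
re-derives ★ results under a weaker frame hypothesis, pays no organ and opens no road (row 2 stays PRINT).

## References
* [Shelstad1979] D. Shelstad, *Characters and inner forms of a quasi-split group over ℝ*, Compositio Math. 39 (1979), §4 property (II) p. 23; Lemma 4.3 p. 25.
* [Bouaziz1994IntegralesOrbitales] A. Bouaziz, *Intégrales orbitales sur les algèbres de Lie réductives*, Ann. Sci. ÉNS 27 (1994), §3.1 (I₁)–(I₂) p. 579; §3.2 p. 580.
* [Varadarajan1977] V. S. Varadarajan, *Harmonic Analysis on Real Reductive Groups*, LNM 576 (1977), Part I §1.12.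
* [Rogawski1990] J. D. Rogawski, *Automorphic Representations of Unitary Groups in Three Variables*, Ann. of Math. Stud. 123 (1990), §8.2 pp. 118–124.
-/

set_option autoImplicit false

noncomputable section

open Set Filter Topology Function MeasureTheory NumberField NumberField.InfinitePlace Complex
open scoped ContDiff MatrixGroups Matrix Classical Real Matrix.Norms.Operator

namespace Literature.NumberTheory.Rogawski1990

open Literature.NumberTheory.Automorphic Literature.NumberTheory.Automorphic.UnitaryGroup Literature.NumberTheory.Automorphic.ArchCartan
open Literature.Analysis.Calculus

section CrossNondeg

variable (L : Type) [Field L] [NumberField L] [IsCMField L] (α : Fin 3 → L)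
  [MeasurableSpace ↥(arch (↥(maximalRealSubfield L)) L (IsCMField.complexConj L) 3 (Matrix.diagonal α))]
  [BorelSpace ↥(arch (↥(maximalRealSubfield L)) L (IsCMField.complexConj L) 3 (Matrix.diagonal α))]
  (ν' : Measure ↥(arch (↥(maximalRealSubfield L)) L (IsCMField.complexConj L) 3 (Matrix.diagonal α))) [ν'.IsHaarMeasure] [ν'.IsMulRightInvariant]

/-- **`hα`-TWIN (N8 census CUT B) of ★ `crossCornerJetBounds_of_unfoldedCornerDescent`: the anisotropy binder `hanis` REPLACED by `hα : ∀ i, α i ≠ 0` — the only way the original reads it (`ne_zero_of_diagonal_anisotropic`); body otherwise VERBATIM.  Hence valid on the quasi-split frame `diag(½,1,−½) ≃ Φ₃` (isotropic).**  ORIGINAL DOCSTRING: Under the `L1Frame` binders (`hherm`, `hanis` ↦ here `hα`, `a′ ∈ C_c^∞(G′_∞)`):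
IF at every admissible label `S`, every enumerated set of compact split-chart places `e : Fin m ↪ W` off `S` and every base point `p` with LITERAL `(0,2)`-coincidences at the `e k`, third
eigenvalue off there and no noncompact coincidence at the other compact places, `orbFamGExt` descends OFF THE CORNER WALLS to the `m`-fold Cayley box integral with the corner root factors
explicit (`hcorner` — the `Fin m` corollary of the (X-core) head `exists_descent_box_orbFamGExt_inRegG_corners`, LH5-p02 (g4): `K`, open `U ∋ p`, one jointly smooth tangential `f` with
one compact block support; quantified over the Cayley carrier `U(J)` and any two-sided Haar `μ₀` on it), THEN the organ text `HcCrossCornerJetBoundsStatement` holds VERBATIM at every cube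
point with no scalar corner — split coordinates ON or OFF their real walls alike: `∃ U ∈ 𝓝 x, BddAbove (‖Dⁿ(orbFamGExt ν′ a′ S′)‖ '' (U ∩ InRegG (slotSign α) S′))`.  Proof: junk labels
trivially (★ `orbFamGExt_of_not_admissible`); induction on the number of places with a `(1,2)`-coincidence via ★ `…_of_hcSwapAt` (LH3-p02); at zero, ★ Layer A′
`exists_nhds_bddAbove_norm_iteratedFDeriv_orbFamGExt_of_unfoldedCornerDescent` on the enumerated coincidence places (all split-chart places, ★ `mem_splitChartPlaces_of_isIndefiniteAt`).
[cite: Shelstad1979, §4 property (II) p. 23] [cite: Bouaziz1994IntegralesOrbitales, §3.1 (I₁)–(I₂) p. 579; §3.2 p. 580] [cite: Varadarajan1977, Part I §1.12] [cite: Rogawski1990, §8.2 pp. 118–124] -/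
theorem crossCornerJetBounds_of_unfoldedCornerDescent_of_ne_zero
    (hherm : ((Matrix.diagonal α).map (cmConjRingHom L)).transpose = Matrix.diagonal α)
    (hα : ∀ i, α i ≠ 0)
    {a' : ↥(arch (↥(maximalRealSubfield L)) L (IsCMField.complexConj L) 3 (Matrix.diagonal α)) → ℂ} (ha' : ArchSmooth L 3 (Matrix.diagonal α) a')
    (hcorner : ∀ {J : Matrix (Fin 2) (Fin 2) ℂ} (hJ : J = (StdForm.antidiagonal 2).over ℂ)
      [MeasurableSpace ↥(unitaryGroupOfForm (starRingEnd ℂ) J)] [BorelSpace ↥(unitaryGroupOfForm (starRingEnd ℂ) J)]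
      [LocallyCompactSpace ↥(unitaryGroupOfForm (starRingEnd ℂ) J)] [SecondCountableTopology ↥(unitaryGroupOfForm (starRingEnd ℂ) J)]
      (μ₀ : Measure ↥(unitaryGroupOfForm (starRingEnd ℂ) J)) [μ₀.IsHaarMeasure] [μ₀.IsMulRightInvariant],
      ∀ (S : Finset {w : InfinitePlace L // IsComplex w}), (∀ w, w ∈ S → w ∈ splitChartPlaces L α) →
      ∀ (m : ℕ) (e : Fin m ↪ {w : InfinitePlace L // IsComplex w}), (∀ k, e k ∉ S) → (∀ k, e k ∈ splitChartPlaces L α) →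
      ∀ (p : {w : InfinitePlace L // IsComplex w} → Fin 3 → ℝ), (∀ k, p (e k) 0 = p (e k) 2) → (∀ k, Circle.exp (p (e k) 1) ≠ Circle.exp (p (e k) 0)) →
      (∀ w, w ∉ S → w ∉ Set.range e → ∀ i j : Fin 3, i ≠ j → slotSign L α w i ≠ slotSign L α w j → Circle.exp (p w i) ≠ Circle.exp (p w j)) →
      ∃ (K : ℂ) (U : Set ({w : InfinitePlace L // IsComplex w} → Fin 3 → ℝ)) (f : ({w : InfinitePlace L // IsComplex w} → Fin 3 → ℝ) × (Fin m → Matrix (Fin 2) (Fin 2) ℂ) → ℂ)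
        (C : Set (Matrix (Fin 2) (Fin 2) ℂ)), IsOpen U ∧ p ∈ U ∧ ContDiff ℝ ∞ f ∧ IsCompact C ∧ (∀ c X, (∃ k, X k ∉ C) → f (c, X) = 0) ∧
        (∀ c c' X, (∀ w, w ∉ Set.range e → c w = c' w) → (∀ k, c (e k) 1 = c' (e k) 1) → f (c, X) = f (c', X)) ∧
        ∀ c ∈ U, (∀ k, Circle.exp (c (e k) 0) ≠ Circle.exp (c (e k) 2)) → orbFamGExt L α ν' a' S c =
          (∏ k, ((1 - (Circle.exp (c (e k) 1 - c (e k) 0) : ℂ)) * (1 - (Circle.exp (c (e k) 2 - c (e k) 0) : ℂ)) * (1 - (Circle.exp (c (e k) 2 - c (e k) 1) : ℂ)))) *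
          (K * ∫ h : Fin m → ↥(unitaryGroupOfForm (starRingEnd ℂ) J),
            f (c, fun k => (((h k * ⟨Matrix.GeneralLinearGroup.mkOfDetNeZero !![(1 : ℂ), 1; 1, -1] det_cayleyTwo_ne_zero *
                  circleDiagonal 2 ![Circle.exp (c (e k) 0), Circle.exp (c (e k) 2)] *
                  (Matrix.GeneralLinearGroup.mkOfDetNeZero !![(1 : ℂ), 1; 1, -1] det_cayleyTwo_ne_zero)⁻¹, cayley_conj_circleDiagonal_mem_of_eq_over hJ _⟩ * (h k)⁻¹ :
                ↥(unitaryGroupOfForm (starRingEnd ℂ) J)) : GL (Fin 2) ℂ) : Matrix (Fin 2) (Fin 2) ℂ)) ∂(Measure.pi fun _ : Fin m => μ₀))) :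
    ∀ (S' : Finset {w : InfinitePlace L // IsComplex w}) (n : ℕ) (x : {w : InfinitePlace L // IsComplex w} → Fin 3 → ℝ),
      (∀ w' : {w : InfinitePlace L // IsComplex w}, w' ∉ S' → ∀ l : Fin 3, x w' l ∈ Ico 0 (2 * π)) →
      (∀ w : {w : InfinitePlace L // IsComplex w}, w ∉ S' → ∀ i j : Fin 3, i ≠ j → slotSign L α w i ≠ slotSign L α w j →
        Circle.exp (x w i) = Circle.exp (x w j) → Circle.exp (x w (hcThird i j)) ≠ Circle.exp (x w i)) →
      (∃ w₁ w₂ : {w : InfinitePlace L // IsComplex w}, w₁ ≠ w₂ ∧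
        (w₁ ∉ S' ∧ ∃ i j : Fin 3, i ≠ j ∧ slotSign L α w₁ i ≠ slotSign L α w₁ j ∧ Circle.exp (x w₁ i) = Circle.exp (x w₁ j)) ∧
        (w₂ ∉ S' ∧ ∃ i j : Fin 3, i ≠ j ∧ slotSign L α w₂ i ≠ slotSign L α w₂ j ∧ Circle.exp (x w₂ i) = Circle.exp (x w₂ j))) →
      ∃ U ∈ 𝓝 x, BddAbove ((fun c => ‖iteratedFDeriv ℝ n (orbFamGExt L α ν' a' S') c‖) '' (U ∩ InRegG (slotSign L α) S')) := by
  intro S' n x hcube hns _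
  -- the frame
  have hreal : ∀ (w' : {w : InfinitePlace L // IsComplex w}) (i : Fin 3), (w'.1.embedding (α i)).im = 0 :=
    im_embedding_diagonal_eq_zero L 3 α (complexConj_apply_eq_of_diagonal_frame hherm)
  -- junk label: the family vanishes
  by_cases hS' : ∀ w, w ∈ S' → w ∈ splitChartPlaces L α
  swap
  · refine ⟨univ, univ_mem, 0, ?_⟩
    rintro _ ⟨c, -, rfl⟩
    show ‖iteratedFDeriv ℝ n (orbFamGExt L α ν' a' S') c‖ ≤ 0
    rw [orbFamGExt_of_not_admissible L α ν' a' S' hS', iteratedFDeriv_fun_zero, Pi.zero_apply, norm_zero]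
  -- the standard rank-one Cayley carrier `U(J)` with a two-sided Haar measure
  obtain ⟨J, hJ⟩ : ∃ J : Matrix (Fin 2) (Fin 2) ℂ, J = (StdForm.antidiagonal 2).over ℂ := ⟨_, rfl⟩
  letI : MeasurableSpace ↥(unitaryGroupOfForm (starRingEnd ℂ) J) := borel _
  haveI : BorelSpace ↥(unitaryGroupOfForm (starRingEnd ℂ) J) := ⟨rfl⟩
  haveI : LocallyCompactSpace ↥(unitaryGroupOfForm (starRingEnd ℂ) J) := locallyCompactSpace_unitaryGroupOfForm_complex J
  haveI : SecondCountableTopology ↥(unitaryGroupOfForm (starRingEnd ℂ) J) := secondCountableTopology_unitaryGroupOfForm_complex J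
  letI : MeasurableSpace (↥(unitaryGroupOfForm (starRingEnd ℂ) J) ⧸ torusU (starRingEnd ℂ) J) := borel _
  haveI : BorelSpace (↥(unitaryGroupOfForm (starRingEnd ℂ) J) ⧸ torusU (starRingEnd ℂ) J) := ⟨rfl⟩
  obtain ⟨μ₀, hμ₀H, hμ₀R, -⟩ := sharedRankOneDatum_exists hJ
  haveI := hμ₀H
  haveI := hμ₀R
  -- slot signs at a place carrying a noncompact pair: `(s, s, −s)`
  have hsigns : ∀ w : {w : InfinitePlace L // IsComplex w}, ∀ i j : Fin 3, i ≠ j → slotSign L α w i ≠ slotSign L α w j →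
      slotSign L α w 1 = slotSign L α w 0 ∧ slotSign L α w 0 ≠ slotSign L α w 2 ∧ w ∈ splitChartPlaces L α := by
    intro w i j _ hsij
    have hind : IsIndefiniteAt (slotSign L α) w := by
      intro hdef
      have h0 : ∀ l : Fin 3, slotSign L α w l = slotSign L α w 0 := by
        intro l
        fin_cases l
        · rfl
        · exact hdef.1.symm
        · exact hdef.2.symm.trans hdef.1.symm
      exact hsij (by rw [h0 i, h0 j])
    have hwsp : w ∈ splitChartPlaces L α := mem_splitChartPlaces_of_isIndefiniteAt L α hα (hreal w) hind
    exact ⟨(slotSign_of_mem_splitChartPlaces L α hα hwsp).1, (slotSign_zero_ne_two_of_mem_splitChartPlaces L α hα hwsp).1, hwsp⟩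
  -- THE INDUCTION on the number of compact places carrying a `(1,2)`-coincidence
  have key : ∀ (N : ℕ) (y : {w : InfinitePlace L // IsComplex w} → Fin 3 → ℝ),
      (∀ w' : {w : InfinitePlace L // IsComplex w}, w' ∉ S' → ∀ l : Fin 3, y w' l ∈ Ico 0 (2 * π)) →
      (∀ w : {w : InfinitePlace L // IsComplex w}, w ∉ S' → ∀ i j : Fin 3, i ≠ j → slotSign L α w i ≠ slotSign L α w j →
        Circle.exp (y w i) = Circle.exp (y w j) → Circle.exp (y w (hcThird i j)) ≠ Circle.exp (y w i)) →
      (Finset.univ.filter fun w : {w : InfinitePlace L // IsComplex w} =>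
          w ∉ S' ∧ slotSign L α w 1 ≠ slotSign L α w 2 ∧ Circle.exp (y w 1) = Circle.exp (y w 2)).card ≤ N →
      ∀ n' : ℕ, ∃ U ∈ 𝓝 y, BddAbove ((fun c => ‖iteratedFDeriv ℝ n' (orbFamGExt L α ν' a' S') c‖) '' (U ∩ InRegG (slotSign L α) S')) := by
    intro N
    induction N with
    | zero =>
      intro y hyc hyns hcard n'
      -- no `(1,2)`-coincidence: every coincident noncompact pair is `(0,2)`; enumerate the coincidence places
      have hno12 : ∀ w : {w : InfinitePlace L // IsComplex w}, w ∉ S' → slotSign L α w 1 ≠ slotSign L α w 2 → Circle.exp (y w 1) ≠ Circle.exp (y w 2) := by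
        intro w hw hs heq
        have hmem : w ∈ Finset.univ.filter fun w : {w : InfinitePlace L // IsComplex w} =>
            w ∉ S' ∧ slotSign L α w 1 ≠ slotSign L α w 2 ∧ Circle.exp (y w 1) = Circle.exp (y w 2) :=
          Finset.mem_filter.2 ⟨Finset.mem_univ _, hw, hs, heq⟩
        rw [Nat.le_zero, Finset.card_eq_zero] at hcard
        rw [hcard] at hmem
        exact absurd hmem (Finset.notMem_empty _)
      set Wc : Finset {w : InfinitePlace L // IsComplex w} := Finset.univ.filter fun w : {w : InfinitePlace L // IsComplex w} =>
        w ∉ S' ∧ ∃ i j : Fin 3, i ≠ j ∧ slotSign L α w i ≠ slotSign L α w j ∧ Circle.exp (y w i) = Circle.exp (y w j) with hWc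
      set e : Fin Wc.card ↪ {w : InfinitePlace L // IsComplex w} := Wc.equivFin.symm.toEmbedding.trans (Function.Embedding.subtype _) with hedef
      have he_mem : ∀ k, e k ∈ Wc := fun k => (Wc.equivFin.symm k).2
      have he_range : ∀ w, w ∈ Wc → w ∈ Set.range e := fun w hw => ⟨Wc.equivFin ⟨w, hw⟩, by simp [hedef]⟩
      -- at a coincidence place the coincident noncompact pair is `(0,2)`
      have hcorner02 : ∀ w, w ∈ Wc → w ∉ S' ∧ y w 0 = y w 2 ∧ Circle.exp (y w 1) ≠ Circle.exp (y w 0) ∧ slotSign L α w 0 ≠ slotSign L α w 2 ∧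
          w ∈ splitChartPlaces L α := by
        intro w hw
        obtain ⟨-, hwS, i, j, hij, hsij, heq⟩ := Finset.mem_filter.1 hw
        obtain ⟨h10, h02, hwsp⟩ := hsigns w i j hij hsij
        have h12 : slotSign L α w 1 ≠ slotSign L α w 2 := by rw [h10]; exact h02
        -- the pair `(i, j)` is `(0,2)` or `(2,0)`: `(0,1)` is compact, `(1,2)` excluded by `hno12`
        have hc02 : Circle.exp (y w 0) = Circle.exp (y w 2) := by
          have hi : i = 0 ∨ i = 1 ∨ i = 2 := by fin_cases i <;> simp
          have hj : j = 0 ∨ j = 1 ∨ j = 2 := by fin_cases j <;> simp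
          rcases hi with rfl | rfl | rfl <;> rcases hj with rfl | rfl | rfl
          · exact absurd rfl hij
          · exact absurd h10.symm hsij
          · exact heq
          · exact absurd h10 hsij
          · exact absurd rfl hij
          · exact absurd heq (hno12 w hwS h12)
          · exact heq.symm
          · exact absurd heq.symm (hno12 w hwS h12)
          · exact absurd rfl hij
        refine ⟨hwS, forall_literal_of_cube (slotSign L α) S' hyc w hwS 0 2 (by decide) h02 hc02, ?_, h02, hwsp⟩
        have h := hyns w hwS 0 2 (by decide) h02 hc02
        rwa [hcThird_zero_two] at h
      obtain ⟨K, U, f, C, hUo, hpU, hf, hC, hfC, htan, hdesc⟩ := hcorner hJ μ₀ S' hS' Wc.card e (fun k => (hcorner02 _ (he_mem k)).1)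
        (fun k => (hcorner02 _ (he_mem k)).2.2.2.2) y (fun k => (hcorner02 _ (he_mem k)).2.1) (fun k => (hcorner02 _ (he_mem k)).2.2.1)
        (fun w hw hwe i j hij hsij heq => hwe (he_range w (Finset.mem_filter.2 ⟨Finset.mem_univ _, hw, i, j, hij, hsij, heq⟩)))
      exact exists_nhds_bddAbove_norm_iteratedFDeriv_orbFamGExt_of_unfoldedCornerDescent L α ν' hJ μ₀ S' e (fun k => (hcorner02 _ (he_mem k)).1)
        (fun k => (hcorner02 _ (he_mem k)).2.2.2.1) (fun k => (hcorner02 _ (he_mem k)).2.1) (fun k => (hcorner02 _ (he_mem k)).2.2.1)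
        (fun w hw hwe i j hij hsij heq => hwe (he_range w (Finset.mem_filter.2 ⟨Finset.mem_univ _, hw, i, j, hij, hsij, heq⟩)))
        K hUo hpU f hf hC hfC htan hdesc n'
    | succ N ih =>
      intro y hyc hyns hcard n'
      by_cases hle : (Finset.univ.filter fun w : {w : InfinitePlace L // IsComplex w} =>
          w ∉ S' ∧ slotSign L α w 1 ≠ slotSign L α w 2 ∧ Circle.exp (y w 1) = Circle.exp (y w 2)).card ≤ N
      · exact ih y hyc hyns hle n'
      -- a place `w` with a `(1,2)`-coincidence; reflect it by `hcSwapAt w 0 1`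
      obtain ⟨w, hwT⟩ : (Finset.univ.filter fun w : {w : InfinitePlace L // IsComplex w} =>
          w ∉ S' ∧ slotSign L α w 1 ≠ slotSign L α w 2 ∧ Circle.exp (y w 1) = Circle.exp (y w 2)).Nonempty := by
        rw [← Finset.card_pos]; omega
      obtain ⟨-, hwS, hs12, hy12⟩ := Finset.mem_filter.1 hwT
      obtain ⟨h10, h02, -⟩ := hsigns w 1 2 (by decide) hs12
      have hy01 : Circle.exp (y w 0) ≠ Circle.exp (y w 1) := by
        have h := hyns w hwS 1 2 (by decide) hs12 hy12
        rwa [hcThird_one_two] at h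
      have hy02 : Circle.exp (y w 0) ≠ Circle.exp (y w 2) := fun h => hy01 (h.trans hy12.symm)
      set y' := hcSwapAt w 0 1 y with hy'def
      have hy'0 : y' w 0 = y w 1 := (hcSwapAt_apply_pair w 0 1 y).1
      have hy'1 : y' w 1 = y w 0 := (hcSwapAt_apply_pair w 0 1 y).2
      have hy'2 : y' w 2 = y w 2 := hcSwapAt_apply_self_of_ne w (show (2 : Fin 3) ≠ 0 by decide) (show (2 : Fin 3) ≠ 1 by decide) y
      have hy'ne : ∀ w', w' ≠ w → y' w' = y w' := fun w' hne => hcSwapAt_apply_of_ne hne 0 1 y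
      -- the reflected point: cube, no scalar corner
      have hy'c : ∀ w' : {w : InfinitePlace L // IsComplex w}, w' ∉ S' → ∀ l : Fin 3, y' w' l ∈ Ico 0 (2 * π) := by
        intro w' hw' l
        by_cases hww : w' = w
        · subst hww
          rw [hy'def, hcSwapAt_apply_self]
          exact hyc w' hw' _
        · rw [hy'ne w' hww]; exact hyc w' hw' l
      have hy'ns : ∀ w' : {w : InfinitePlace L // IsComplex w}, w' ∉ S' → ∀ i j : Fin 3, i ≠ j → slotSign L α w' i ≠ slotSign L α w' j →
          Circle.exp (y' w' i) = Circle.exp (y' w' j) → Circle.exp (y' w' (hcThird i j)) ≠ Circle.exp (y' w' i) := by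
        intro w' hw' i j hij hsij heq
        by_cases hww : w' = w
        · subst hww
          -- at `w` the only coincidence of `y′` is the pair `(0,2)`, with third eigenvalue `e^{i y_{w,0}}` off it
          have hi : i = 0 ∨ i = 1 ∨ i = 2 := by fin_cases i <;> simp
          have hj : j = 0 ∨ j = 1 ∨ j = 2 := by fin_cases j <;> simp
          rcases hi with rfl | rfl | rfl <;> rcases hj with rfl | rfl | rfl
          · exact absurd rfl hij
          · rw [hy'0, hy'1] at heq; exact absurd heq.symm hy01
          · rw [hcThird_zero_two, hy'1, hy'0]; exact hy01
          · rw [hy'1, hy'0] at heq; exact absurd heq hy01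
          · exact absurd rfl hij
          · rw [hy'1, hy'2] at heq; exact absurd heq hy02
          · rw [show hcThird (2 : Fin 3) 0 = 1 by decide, hy'1, hy'2]; exact hy02
          · rw [hy'2, hy'1] at heq; exact absurd heq.symm hy02
          · exact absurd rfl hij
        · simp only [hy'ne w' hww] at heq ⊢
          exact hyns w' hw' i j hij hsij heq
      -- one `(1,2)`-place fewer
      have hcard' : (Finset.univ.filter fun w' : {w : InfinitePlace L // IsComplex w} =>
          w' ∉ S' ∧ slotSign L α w' 1 ≠ slotSign L α w' 2 ∧ Circle.exp (y' w' 1) = Circle.exp (y' w' 2)).card ≤ N := by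
        have hsub : (Finset.univ.filter fun w' : {w : InfinitePlace L // IsComplex w} =>
            w' ∉ S' ∧ slotSign L α w' 1 ≠ slotSign L α w' 2 ∧ Circle.exp (y' w' 1) = Circle.exp (y' w' 2)) ⊆
            (Finset.univ.filter fun w' : {w : InfinitePlace L // IsComplex w} =>
              w' ∉ S' ∧ slotSign L α w' 1 ≠ slotSign L α w' 2 ∧ Circle.exp (y w' 1) = Circle.exp (y w' 2)).erase w := by
          intro w' hw'
          obtain ⟨-, hw'S, hs', heq'⟩ := Finset.mem_filter.1 hw'
          by_cases hww : w' = w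
          · subst hww
            rw [hy'1, hy'2] at heq'
            exact absurd heq' hy02
          · exact Finset.mem_erase.2 ⟨hww, Finset.mem_filter.2 ⟨Finset.mem_univ _, hw'S, hs', by rwa [hy'ne w' hww] at heq'⟩⟩
        have h := Finset.card_le_card hsub
        rw [Finset.card_erase_of_mem hwT] at h
        omega
      -- transport the bounds at the reflected point back across the compact reflection `(0 1)` at `w`
      exact exists_nhds_bddAbove_norm_iteratedFDeriv_orbFamGExt_of_hcSwapAt L α ν' hα hreal hS' ha' hwS (show (0 : Fin 3) ≠ 1 by decide) h10.symm
        (fun m' _ => ih y' hy'c hy'ns hcard' m')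
  exact key _ x hcube hns le_rfl n

/-- **`hα`-TWIN (N8 census CUT B) of ★ `crossCornerJetBounds` — (I₁) AT THE CROSS-PLACE CORNERS for ANY non-degenerate real diagonal frame (`hα`, `hherm`), anisotropic or not (e.g. the quasi-split `U(2,1)^d` frame `diag(½,1,−½)`).**  ORIGINAL:  Under the `L1Frame` binders (`hherm`: the diagonal frame is hermitian for
the CM conjugation; `hanis`: anisotropic; `a′ ∈ C_c^∞(G′_∞)`), at EVERY point `x` of the fundamental cube with no scalar corner (every coincident noncompact pair of angular
coordinates at a compact non-`S′` place has its third eigenvalue off the pair) — the split coordinates arbitrary, on or off the real walls — every jet of the extended chart family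
`orbFamGExt ν′ a′ S′` is bounded near `x` on `InRegG (slotSign α) S′`: `∃ U ∈ 𝓝 x, BddAbove (‖Dⁿ(orbFamGExt ν′ a′ S′)‖ '' (U ∩ InRegG (slotSign α) S′))`.  (The «two coincidence
places» hypothesis of the organ text is not used.)  = §2 `crossCornerJetBounds_of_unfoldedCornerDescent` ∘ §3 `exists_descent_box_orbFamGExt_inRegG_corners_fin` (★ LH5-p02's
(X-core) head), frame facts ★ `ne_zero_of_diagonal_anisotropic`, ★ `im_embedding_diagonal_eq_zero` ∘ ★ `complexConj_apply_eq_of_diagonal_frame`.  This is the text of the leaf's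
`HcCrossCornerJetBoundsStatement` under `L1Frame` (Harish-Chandra's property (I₁) of the normalised orbital integrals at the corners of the compact Cartan, for `U(2,1)^{[F:ℚ]}`-type
inner forms: Shelstad's property (II), Bouaziz (I₁)–(I₂)).
[cite: Shelstad1979, §4 property (II) p. 23; Lemma 4.3 p. 25] [cite: Bouaziz1994IntegralesOrbitales, §3.1 (I₁)–(I₂) p. 579; §3.2 p. 580] [cite: Varadarajan1977, Part I §1.12] [cite: Rogawski1990, §8.2 pp. 118–124] -/
theorem crossCornerJetBounds_of_ne_zero
    (hherm : ((Matrix.diagonal α).map (cmConjRingHom L)).transpose = Matrix.diagonal α)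
    (hα : ∀ i, α i ≠ 0)
    {a' : ↥(arch (↥(maximalRealSubfield L)) L (IsCMField.complexConj L) 3 (Matrix.diagonal α)) → ℂ} (ha' : ArchSmooth L 3 (Matrix.diagonal α) a') :
    ∀ (S' : Finset {w : InfinitePlace L // IsComplex w}) (n : ℕ) (x : {w : InfinitePlace L // IsComplex w} → Fin 3 → ℝ),
      (∀ w' : {w : InfinitePlace L // IsComplex w}, w' ∉ S' → ∀ l : Fin 3, x w' l ∈ Ico 0 (2 * π)) →
      (∀ w : {w : InfinitePlace L // IsComplex w}, w ∉ S' → ∀ i j : Fin 3, i ≠ j → slotSign L α w i ≠ slotSign L α w j →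
        Circle.exp (x w i) = Circle.exp (x w j) → Circle.exp (x w (hcThird i j)) ≠ Circle.exp (x w i)) →
      (∃ w₁ w₂ : {w : InfinitePlace L // IsComplex w}, w₁ ≠ w₂ ∧
        (w₁ ∉ S' ∧ ∃ i j : Fin 3, i ≠ j ∧ slotSign L α w₁ i ≠ slotSign L α w₁ j ∧ Circle.exp (x w₁ i) = Circle.exp (x w₁ j)) ∧
        (w₂ ∉ S' ∧ ∃ i j : Fin 3, i ≠ j ∧ slotSign L α w₂ i ≠ slotSign L α w₂ j ∧ Circle.exp (x w₂ i) = Circle.exp (x w₂ j))) →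
      ∃ U ∈ 𝓝 x, BddAbove ((fun c => ‖iteratedFDeriv ℝ n (orbFamGExt L α ν' a' S') c‖) '' (U ∩ InRegG (slotSign L α) S')) :=
  crossCornerJetBounds_of_unfoldedCornerDescent_of_ne_zero L α ν' hherm hα ha' fun {_} hJ _ _ _ _ μ₀ _ _ _ hS _ e he hesp _ hp02 hp1 hinreg =>
    exists_descent_box_orbFamGExt_inRegG_corners_fin L α ν' hα
      (im_embedding_diagonal_eq_zero L 3 α (complexConj_apply_eq_of_diagonal_frame hherm)) hJ μ₀ hS e he hesp hp02 hp1 hinreg ha'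

end CrossNondeg

end Literature.NumberTheory.Rogawski1990

end
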